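import Summits.Ventures.CertifiedArithmetic.Expansions.WeakExpansion
import Summits.Ventures.CertifiedArithmetic.Expansions.Orient2dEstimate
import Literature.ComputerArithmetic.BoldoJeannerodMelquiondMuller2023.RoundToNearestEven

/-!
# `estimate` (APPROXIMATE) errs by MORE than one ulp — and by more than `2ε` relative — on a
# strongly nonoverlapping expansion under round-to-even, at every precision `p ≥ 4`

HONEST FRAMING (ENGINES group, unit `eng-quad-4`, kernels lane of the `certquad` engine — shared
numerical engines serving client cells; rigour lives in the verifiers; every published number
belongs to a client cell's ledger, not to the engines group): NEW WORK of the lane's Lean line (a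
witness family and its kernel-checked run), not a published result; it lives under
`Summits/Ventures/` and carries no citation tag of its own.  Findings about the printed text are
RECORDED, NOT ADJUDICATED; nothing is claimed about the C code `predicates.c` or about the behaviour
of any predicate on any input.

THE PRINTED STATEMENTS (J. R. Shewchuk, Discrete Comput. Geom. 18 (1997) 305–363 [Shewchuk1997];
`ε = ½ulp(1) = 2^−p`, p. 336, is `unitRoundoff p`).  §2.7, p. 333, after Theorem 23 (COMPRESS;
`e` "a nonoverlapping expansion of `m ≥ 3` `p`-bit components … sorted in order of increasing
magnitude, except that any of the `eᵢ` may be zero"): "The fastest way to approximate `e` is simply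
to sum its components from the smallest to the largest; by the reasoning used above, the result
errs by less than one ulp. This observation is the basis for an APPROXIMATE procedure that is used
in the predicates of Section 4."  §4.3, p. 349 (Table 1, ORIENT2D): "The bound for `B′` takes
advantage of Theorem 23, which shows that `B′` approximates `B` with relative error less than
`2ε`."  The `B′` lines of Tables 1, 3, 5 (pp. 349, 351, 352: `(2ε + 12ε²)`, `(3ε + 28ε²)`,
`(4ε + 48ε²)`) and their `C` lines (`(3ε + 8ε²) ⊗ |B′| ⊕ …`) rest on this `2ε`.

KNOWN BEFORE THIS FILE (in this development).  For a merely nonoverlapping expansion the remark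
fails outright (`⟨15/16, 15, −16⟩`, `p = 4`, any round-to-nearest: `estimate = 0 ≠ Σ =
−1/16`, `Orient2dEstimate`) — but that list is not STRONGLY nonoverlapping, i.e. not of the kind
the paper's algorithms hand to APPROXIMATE.  On the class `W ⊇ SNS` of weakly nonoverlapping
expansions `estimate` IS sign-faithful (`EstimateWeakExpansion`) with the relative bound `3u`
(`EstimateRelativeError`, proposed separately, not imported here); exhaustive small-precision
searches recorded with `Orient3dStageBMargins` / `IncircleStageBMargins` found round-to-even
overshoots of `2.13ε` (`p = 5`), `2.30ε` (`p = 6`), leaving `p = 53` undecided "either way".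

THIS FILE settles it for every precision at once, INSIDE the strongly nonoverlapping class and under
the IEEE-754 default rounding (round-to-nearest ties-to-even,
`BoldoJeannerodMelquiondMuller2023.roundTiesEven`).  For every `p ≥ 4` and exponent floor
`emin ≤ 0` the four `p`-bit floats  `l = ⟨1, −(2^(p+1) − 4), −2^(p+2), 2^(p+3)⟩`  form a STRONGLY
NONOVERLAPPING expansion (`1` lies 2-below everything; `2^(p+1) − 4 = (2^(p−1) − 1)·4` occupies
the bits `2² … 2^p` and is not adjacent to `2^(p+2)`; `2^(p+2), 2^(p+3)` is an isolated adjacent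
pair of one-bit components — the configuration of Fig. 14, p. 331), hence a `W` expansion, with
`Σ l = 2^(p+1) + 5` and `estimate l = RNₑ(RNₑ(RNₑ(1 − (2^(p+1) − 4)) − 2^(p+2)) + 2^(p+3)) =
2^(p+1)`:
* `1 − (2^(p+1) − 4) = −(2^(p+1) − 5)` is the midpoint of the consecutive floats
  `−(2^(p+1) − 4)`, `−(2^(p+1) − 6)` (binade `[2^p, 2^(p+1))`, `ulp = 2`); ties-to-even returns
  `−(2^(p+1) − 4)` (scaled significand `2^p − 2`, even) — error `1` (`roundTiesEven_tie₁`);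
* `−(2^(p+1) − 4) − 2^(p+2) = −(3·2^(p+1) − 4)` is the midpoint of `−3·2^(p+1)`,
  `−(3·2^(p+1) − 8)` (binade `[2^(p+2), 2^(p+3))`, `ulp = 8`); ties-to-even returns `−3·2^(p+1)`
  (scaled significand `3·2^(p−2)`, even) — error `4`, in the same direction (`roundTiesEven_tie₂`);
* `−3·2^(p+1) + 2^(p+3) = 2^(p+1)` is a float: no error.
So `|estimate l − Σ l| = 5` while `ulp(estimate l) = ulp(2^(p+1)) = 4 = ulp(Σ l)`: the result errs
by `5/4` ulp; and `5 > 2ε·|Σ l| = 4 + 10·2^−p` (as `p ≥ 4`), indeed `5 > 2ε·|estimate l| = 4`: the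
relative error `5/(2^(p+1) + 5) = ε·5/(2 + 5ε) = (5/2 − O(ε))·ε` EXCEEDS `2ε` whether measured
against the true or the computed value — at `p = 53` it is `ε·5/(2 + 5·2^−53)`
(`estimate_counterexample_family`, `estimate_counterexample_binary64`).  At `p = 4`, the paper's
running precision: `l = ⟨1, −28, −64, 128⟩`, running sums `−27 ↦ −28`, `−92 ↦ −96`, `32`;
`Σ = 37`, error `5 = 2.16ε·Σ` (`estimate_counterexample_four`).

CONSEQUENCES (recorded, not adjudicated).  (i) The §2.7 remark is false as printed — already on
strongly nonoverlapping input, under round-to-even, at every `p ≥ 4` (`approximateRemark_false`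
refutes its restriction to that class).  The "reasoning used above" bounds `|h − hₙ|` for
COMPRESS, whose
second traversal consists of error-free FAST-TWO-SUMs that KEEP every roundoff as a component; a
plain floating-point accumulation discards the roundoffs, and they add up (`1 + 4` here).  (ii) The
relative error APPROXIMATE can commit on the paper's own class of expansions is at least
`ε·5/(2 + 5ε)`, so the sentence of p. 349 (`< 2ε`) fails at every `p ≥ 4`, binary64 included
(`approximateTwoEps_false`); any UNIFORM estimate bound `δ = kε` over strongly nonoverlapping (a
fortiori `W`) expansions — the only kind this development has — needs `k ≥ 5/(2 + 5ε) > 7/3`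
from `p ≥ 6` on: by `Orient3dStageBMargins` (margin closes "only for `k ≤ 7/3`") the printed
ORIENT3D coefficient `(3ε + 28ε²)` of Table 3, line B is out of reach of the stage-B margin
argument of this development with any valid uniform `δ`, for every `p ≥ 6`.  The printed
INCIRCLE line B (`(4ε + 48ε²)`, margin needs `k < 5/2`) and the `C` lines (`(3ε + 8ε²) ⊗ |B′|`,
certified by `Orient3dStageCMargins` for `δ = 5ε/2` from `p ≥ 5`) are NOT excluded by this
family: they hinge on whether the worst relative error of `estimate` on such expansions stays
below `5ε/2`, which is OPEN (proved: `≤ 3ε`; the development certifies `(3ε + 32ε²)`,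
`(4ε + 56ε²)`, `(3ε + 24ε²) ⊗ |B′|` instead).  (iii) None of this exhibits an input on which a
predicate of `predicates.c` returns a wrong sign; whether `l` can occur as an actual `B` of
ORIENT3D / INCIRCLE is not claimed either way; for ORIENT2D's four-component `B` the development
proves a bound of the printed mixed type directly (`Orient2dDetBApprox`), independently of p. 349.

EVIDENCE beyond the theorem (exhaustive search in an exact integer model of ties-to-even over the
strongly nonoverlapping lists of `p`-bit floats with smallest component odd, last one positive,
top bit below `2^E`, length `≤ n`, nonzero sum; scripts kept in the unit's drafts, not the tree):
`(p, E, n) = (4, 12, 5)`: 59 922 lists, max `|estimate − Σ|/(ε|Σ|) = 2.255` at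
`⟨−11, −32, −64, −256, 512⟩`; `(4, 16, 6)`: 2 767 794 lists, `2.298` at
`⟨15, −352, −1024, −2048, −8192, 16384⟩`; `(5, 16, 6)`: 3 922 610 lists, `2.352` at
`⟨1, −60, −128, −3584, −8192, 16384⟩`; `(6, 18, 6)`: 28 065 538 lists, `2.424` at
`⟨1, −124, −256, −15360, −32768, 65536⟩` (the family above with one more tie stacked on top);
largest `|estimate − Σ|/ulp(estimate)` found `1.31, 1.34, 1.34, 1.36`.  No list reached `5ε/2`;
we do NOT claim `5/2` is the supremum.

PROVED HERE (0 sorry, no definitions): the thirteen theorems below.  References: [Shewchuk1997]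
§2.7 p. 333 (the remark refuted), Theorem 23 pp. 331–332, §4.3 p. 349, Tables 1, 3, 5 (pp. 349,
351, 352), §2.4 p. 318 and Fig. 14 (strongly nonoverlapping); `estimate` is the routine of
`Orient2dEstimate.lean` (`predicates.c`'s `estimate`, APPROXIMATE summed smallest first);
round-to-even is `Literature/ComputerArithmetic/BoldoJeannerodMelquiondMuller2023/
RoundToNearestEven.lean`; the class is `IsStrongExpansion` of `Literature/…/Shewchuk1997/
FastExpansionSum.lean` (and `IsWeakExpansion` of `WeakExpansion.lean`).
-/

namespace Summit.Ventures.CertifiedArithmetic.Expansions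

open Literature.ComputerArithmetic.JeannerodRump2018 (IsFloat IsRoundNearest unitRoundoff)
open Literature.ComputerArithmetic.BoldoJeannerodMelquiondMuller2023 (roundTiesEven ulp
  ulp_of_ne_zero isRoundNearest_roundTiesEven roundTiesEven_of_tie roundTiesEven_eq_self)
open Literature.ComputerArithmetic.Shewchuk1997

/-! ### The witness, precision `p = j + 4` (`2^(p+1) = 32·2^j`) -/

/-- The components of `l = ⟨1, −(2^(p+1) − 4), −2^(p+2), 2^(p+3)⟩` are `p`-bit floats:
`1·2⁰`, `−(2^(p−1) − 1)·2²`, `−1·2^(p+2)`, `1·2^(p+3)` (`emin ≤ 0`). -/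
theorem ce_isFloat (j : ℕ) {emin : ℤ} (hemin : emin ≤ 0) :
    ∀ x ∈ [1, 4 - 32 * (2 : ℚ) ^ j, -(64 * (2 : ℚ) ^ j), 128 * (2 : ℚ) ^ j],
      IsFloat (j + 4) emin x := by
  have h1 : (1 : ℤ) ≤ 2 ^ j := one_le_pow₀ (by norm_num)
  intro x hx
  simp only [List.mem_cons, List.not_mem_nil, or_false] at hx
  rcases hx with rfl | rfl | rfl | rfl
  · refine ⟨1, 0, ?_, hemin, by norm_num⟩
    rw [abs_one]; exact one_lt_pow₀ (by norm_num) (by omega)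
  · refine ⟨1 - 8 * 2 ^ j, 2, ?_, by omega, ?_⟩
    · rw [show (2 : ℤ) ^ (j + 4) = 16 * 2 ^ j by ring, abs_of_neg (by linarith)]; linarith
    · rw [zpow_two]; push_cast; ring
  · refine ⟨-1, (j : ℤ) + 6, ?_, by omega, ?_⟩
    · rw [abs_neg, abs_one]; exact one_lt_pow₀ (by norm_num) (by omega)
    · rw [zpow_add₀ (by norm_num : (2 : ℚ) ≠ 0), zpow_natCast]; push_cast; ring
  · refine ⟨1, (j : ℤ) + 7, ?_, by omega, ?_⟩
    · rw [abs_one]; exact one_lt_pow₀ (by norm_num) (by omega)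
    · rw [zpow_add₀ (by norm_num : (2 : ℚ) ≠ 0), zpow_natCast]; push_cast; ring

/-- **`l` IS STRONGLY NONOVERLAPPING** ([Shewchuk1997] §2.4 p. 318): `1` lies 2-below the other
three (all multiples of `4 > 2·1`); `−(2^(p+1) − 4)` lies 2-below `∓2^(p+2)`, `2^(p+3)`
(multiples of `2^(p+2) > 2·(2^(p+1) − 4)`); `2^(p+2), 2^(p+3)` are the adjacent pair of one-bit
numbers `2^a, 2^(a+1)`; and no component sees both its half and its double among the magnitudes. -/
theorem ce_isStrongExpansion (j : ℕ) :
    IsStrongExpansion [1, 4 - 32 * (2 : ℚ) ^ j, -(64 * (2 : ℚ) ^ j), 128 * (2 : ℚ) ^ j] := by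
  have ht1 : (1 : ℚ) ≤ 2 ^ j := one_le_pow₀ (by norm_num)
  have e1 : |(1 : ℚ)| = 1 := abs_one
  have e2 : |(4 - 32 * 2 ^ j : ℚ)| = 32 * 2 ^ j - 4 := by rw [abs_of_neg (by linarith)]; ring
  have e3 : |(-(64 * 2 ^ j) : ℚ)| = 64 * 2 ^ j := by rw [abs_neg, abs_of_pos (by positivity)]
  have e4 : |(128 * 2 ^ j : ℚ)| = 128 * 2 ^ j := abs_of_pos (by positivity)
  refine ⟨List.Pairwise.cons ?_ (List.Pairwise.cons ?_
    (List.Pairwise.cons ?_ (List.pairwise_singleton _ _))), ?_⟩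
  · intro y hy
    simp only [List.mem_cons, List.not_mem_nil, or_false] at hy
    rcases hy with rfl | rfl | rfl
    · exact Or.inl ⟨2, ⟨1 - 8 * 2 ^ j, by rw [zpow_two]; push_cast; ring⟩, by norm_num⟩
    · exact Or.inl ⟨2, ⟨-(16 * 2 ^ j), by rw [zpow_two]; push_cast; ring⟩, by norm_num⟩
    · exact Or.inl ⟨2, ⟨32 * 2 ^ j, by rw [zpow_two]; push_cast; ring⟩, by norm_num⟩
  · intro y hy
    simp only [List.mem_cons, List.not_mem_nil, or_false] at hy
    rcases hy with rfl | rfl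
    · refine Or.inl ⟨(j : ℤ) + 6, ⟨-1, ?_⟩, ?_⟩
      · rw [zpow_add₀ (by norm_num : (2 : ℚ) ≠ 0), zpow_natCast]; push_cast; ring
      · rw [e2, zpow_add₀ (by norm_num : (2 : ℚ) ≠ 0), zpow_natCast]; norm_num; linarith
    · refine Or.inl ⟨(j : ℤ) + 6, ⟨2, ?_⟩, ?_⟩
      · rw [zpow_add₀ (by norm_num : (2 : ℚ) ≠ 0), zpow_natCast]; push_cast; ring
      · rw [e2, zpow_add₀ (by norm_num : (2 : ℚ) ≠ 0), zpow_natCast]; norm_num; linarith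
  · intro y hy
    rw [List.mem_singleton.mp hy]
    refine Or.inr ⟨(j : ℤ) + 6, ?_, ?_⟩
    · rw [e3, zpow_add₀ (by norm_num : (2 : ℚ) ≠ 0), zpow_natCast]; push_cast; ring
    · rw [e4, show (j : ℤ) + 6 + 1 = (j : ℤ) + 7 by ring, zpow_add₀ (by norm_num : (2 : ℚ) ≠ 0),
        zpow_natCast]; push_cast; ring
  · intro y hy hy0 h1 h2
    simp only [List.mem_cons, List.not_mem_nil, or_false] at hy
    rcases hy with rfl | rfl | rfl | rfl <;>
      simp only [List.map_cons, List.map_nil, e1, e2, e3, e4, List.mem_cons, List.not_mem_nil,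
        or_false] at h1 h2
    · rcases h1 with h | h | h | h <;> linarith
    · rcases h1 with h | h | h | h <;> linarith
    · rcases h1 with h | h | h | h <;> linarith
    · rcases h2 with h | h | h | h <;> linarith

/-- `Σ l = 1 − (2^(p+1) − 4) − 2^(p+2) + 2^(p+3) = 2^(p+1) + 5`. -/
theorem ce_sum (j : ℕ) :
    ([1, 4 - 32 * (2 : ℚ) ^ j, -(64 * (2 : ℚ) ^ j), 128 * (2 : ℚ) ^ j] : List ℚ).sum
      = 32 * 2 ^ j + 5 := by
  simp only [List.sum_cons, List.sum_nil]; ring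

/-- THE FIRST TIE.  `1 ⊕ (−(2^(p+1) − 4)) = RNₑ(5 − 32·2^j)`: the argument `−(2^(p+1) − 5)` lies
halfway between the consecutive floats `−(2^(p+1) − 4)` and `−(2^(p+1) − 6)` (`ulp = 2` in the
binade `[2^p, 2^(p+1))`); round-to-even picks the even scaled significand `2^p − 2 = −⌊·/2⌋`,
i.e. `−(2^(p+1) − 4) = 4 − 32·2^j` — error `1`, toward zero. -/
theorem roundTiesEven_tie₁ (j : ℕ) {emin : ℤ} (hemin : emin ≤ 1) :
    roundTiesEven (j + 4) emin (5 - 32 * 2 ^ j) = 4 - 32 * 2 ^ j := by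
  have ht1 : (1 : ℚ) ≤ 2 ^ j := one_le_pow₀ (by norm_num)
  have hx0 : (5 - 32 * 2 ^ j : ℚ) ≠ 0 := by intro h; linarith
  have hpos : 0 < |(5 - 32 * 2 ^ j : ℚ)| := abs_pos.mpr hx0
  have habs : |(5 - 32 * 2 ^ j : ℚ)| = 32 * 2 ^ j - 5 := by
    rw [abs_of_neg (by linarith)]; ring
  have h2 : (2 : ℚ) ≠ 0 := by norm_num
  have hlog : Int.log 2 |(5 - 32 * 2 ^ j : ℚ)| = (j : ℤ) + 4 := by
    apply le_antisymm
    · have hlt : |(5 - 32 * 2 ^ j : ℚ)| < ((2 : ℕ) : ℚ) ^ ((j : ℤ) + 4 + 1) := by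
        rw [habs, Nat.cast_ofNat, zpow_add_one₀ h2, zpow_add₀ h2, zpow_natCast]; norm_num; linarith
      have := (Int.lt_zpow_iff_log_lt (b := 2) (by norm_num) hpos).mp hlt
      omega
    · have hle : ((2 : ℕ) : ℚ) ^ ((j : ℤ) + 4) ≤ |(5 - 32 * 2 ^ j : ℚ)| := by
        rw [habs, Nat.cast_ofNat, zpow_add₀ h2, zpow_natCast]; norm_num; linarith
      exact (Int.zpow_le_iff_le_log (b := 2) (by norm_num) hpos).mp hle
  have hu : ulp (j + 4) emin (5 - 32 * 2 ^ j) = 2 := by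
    rw [ulp_of_ne_zero hx0, hlog]
    have : (j : ℤ) + 4 - ((j + 4 : ℕ) : ℤ) + 1 = 1 := by push_cast; ring
    rw [this, max_eq_right hemin, zpow_one]
  have hN : ⌊(5 - 32 * 2 ^ j : ℚ) / 2⌋ = 2 - 16 * 2 ^ j := by
    rw [Int.floor_eq_iff]; push_cast; constructor <;> linarith
  have htie : (5 - 32 * 2 ^ j : ℚ) -
        (⌊(5 - 32 * 2 ^ j : ℚ) / ulp (j + 4) emin (5 - 32 * 2 ^ j)⌋ : ℚ) *
          ulp (j + 4) emin (5 - 32 * 2 ^ j) =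
      ((⌊(5 - 32 * 2 ^ j : ℚ) / ulp (j + 4) emin (5 - 32 * 2 ^ j)⌋ : ℚ) + 1) *
          ulp (j + 4) emin (5 - 32 * 2 ^ j) - (5 - 32 * 2 ^ j) := by
    rw [hu, hN]; push_cast; ring
  have heven : Even ⌊(5 - 32 * 2 ^ j : ℚ) / ulp (j + 4) emin (5 - 32 * 2 ^ j)⌋ := by
    rw [hu, hN]; exact ⟨1 - 8 * 2 ^ j, by ring⟩
  rw [roundTiesEven_of_tie htie, if_pos heven, hu, hN]; push_cast; ring

/-- THE SECOND TIE.  `(−(2^(p+1) − 4)) ⊕ (−2^(p+2)) = RNₑ(4 − 96·2^j)`: the argument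
`−(3·2^(p+1) − 4)` lies halfway between the consecutive floats `−3·2^(p+1)` and `−(3·2^(p+1) − 8)`
(`ulp = 8` in the binade `[2^(p+2), 2^(p+3))`); round-to-even picks the even scaled significand
`−3·2^(p−2) = ⌊·/8⌋`, i.e. `−3·2^(p+1) = −96·2^j` — error `4`, again toward zero. -/
theorem roundTiesEven_tie₂ (j : ℕ) {emin : ℤ} (hemin : emin ≤ 3) :
    roundTiesEven (j + 4) emin (4 - 96 * 2 ^ j) = -(96 * 2 ^ j) := by
  have ht1 : (1 : ℚ) ≤ 2 ^ j := one_le_pow₀ (by norm_num)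
  have hx0 : (4 - 96 * 2 ^ j : ℚ) ≠ 0 := by intro h; linarith
  have hpos : 0 < |(4 - 96 * 2 ^ j : ℚ)| := abs_pos.mpr hx0
  have habs : |(4 - 96 * 2 ^ j : ℚ)| = 96 * 2 ^ j - 4 := by
    rw [abs_of_neg (by linarith)]; ring
  have h2 : (2 : ℚ) ≠ 0 := by norm_num
  have hlog : Int.log 2 |(4 - 96 * 2 ^ j : ℚ)| = (j : ℤ) + 6 := by
    apply le_antisymm
    · have hlt : |(4 - 96 * 2 ^ j : ℚ)| < ((2 : ℕ) : ℚ) ^ ((j : ℤ) + 6 + 1) := by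
        rw [habs, Nat.cast_ofNat, zpow_add_one₀ h2, zpow_add₀ h2, zpow_natCast]; norm_num; linarith
      have := (Int.lt_zpow_iff_log_lt (b := 2) (by norm_num) hpos).mp hlt
      omega
    · have hle : ((2 : ℕ) : ℚ) ^ ((j : ℤ) + 6) ≤ |(4 - 96 * 2 ^ j : ℚ)| := by
        rw [habs, Nat.cast_ofNat, zpow_add₀ h2, zpow_natCast]; norm_num; linarith
      exact (Int.zpow_le_iff_le_log (b := 2) (by norm_num) hpos).mp hle
  have hu : ulp (j + 4) emin (4 - 96 * 2 ^ j) = 8 := by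
    rw [ulp_of_ne_zero hx0, hlog]
    have : (j : ℤ) + 6 - ((j + 4 : ℕ) : ℤ) + 1 = 3 := by push_cast; ring
    rw [this, max_eq_right hemin]; norm_num
  have hN : ⌊(4 - 96 * 2 ^ j : ℚ) / 8⌋ = -(12 * 2 ^ j) := by
    rw [Int.floor_eq_iff]; push_cast; constructor <;> linarith
  have htie : (4 - 96 * 2 ^ j : ℚ) -
        (⌊(4 - 96 * 2 ^ j : ℚ) / ulp (j + 4) emin (4 - 96 * 2 ^ j)⌋ : ℚ) *
          ulp (j + 4) emin (4 - 96 * 2 ^ j) =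
      ((⌊(4 - 96 * 2 ^ j : ℚ) / ulp (j + 4) emin (4 - 96 * 2 ^ j)⌋ : ℚ) + 1) *
          ulp (j + 4) emin (4 - 96 * 2 ^ j) - (4 - 96 * 2 ^ j) := by
    rw [hu, hN]; push_cast; ring
  have heven : Even ⌊(4 - 96 * 2 ^ j : ℚ) / ulp (j + 4) emin (4 - 96 * 2 ^ j)⌋ := by
    rw [hu, hN]; exact ⟨-(6 * 2 ^ j), by ring⟩
  rw [roundTiesEven_of_tie htie, if_pos heven, hu, hN]; push_cast; ring

/-- The value returned, `2^(p+1) = 32·2^j = 1·2^(j+5)`, is a float. -/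
theorem isFloat_estimate_ce (j : ℕ) {emin : ℤ} (hemin : emin ≤ 0) :
    IsFloat (j + 4) emin (32 * 2 ^ j) := by
  refine ⟨1, (j : ℤ) + 5, ?_, by omega, ?_⟩
  · rw [abs_one]; exact one_lt_pow₀ (by norm_num) (by omega)
  · rw [zpow_add₀ (by norm_num : (2 : ℚ) ≠ 0), zpow_natCast]; push_cast; ring

/-- THE RUN (`p = j + 4`, round-to-even, `emin ≤ 0`): `estimate l = ((1 ⊕ (4 − 32·2^j)) ⊕
(−64·2^j)) ⊕ 128·2^j = (−96·2^j) ⊕ 128·2^j = 32·2^j` (the two ties, then an exact addition). -/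
theorem estimate_ce (j : ℕ) {emin : ℤ} (hemin : emin ≤ 0) :
    estimate (roundTiesEven (j + 4) emin)
      [1, 4 - 32 * (2 : ℚ) ^ j, -(64 * (2 : ℚ) ^ j), 128 * (2 : ℚ) ^ j] = 32 * 2 ^ j := by
  rw [estimate_four, show (1 + (4 - 32 * 2 ^ j) : ℚ) = 5 - 32 * 2 ^ j by ring,
    roundTiesEven_tie₁ j (by omega : emin ≤ 1),
    show (4 - 32 * 2 ^ j + -(64 * 2 ^ j) : ℚ) = 4 - 96 * 2 ^ j by ring,
    roundTiesEven_tie₂ j (by omega : emin ≤ 3),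
    show (-(96 * 2 ^ j) + 128 * 2 ^ j : ℚ) = 32 * 2 ^ j by ring]
  exact roundTiesEven_eq_self (by omega) (isFloat_estimate_ce j hemin)

/-- `ulp(2^(p+1)) = ulp(2^(p+1) + 5) = 4` (binade `[2^(p+1), 2^(p+2))`, `emin ≤ 2`). -/
theorem ulp_ce (j : ℕ) {emin : ℤ} (hemin : emin ≤ 2) :
    ulp (j + 4) emin (32 * 2 ^ j) = 4 ∧ ulp (j + 4) emin (32 * 2 ^ j + 5) = 4 := by
  have ht1 : (1 : ℚ) ≤ 2 ^ j := one_le_pow₀ (by norm_num)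
  have h2 : (2 : ℚ) ≠ 0 := by norm_num
  have key : ∀ x : ℚ, 32 * 2 ^ j ≤ x → x < 64 * 2 ^ j → ulp (j + 4) emin x = 4 := by
    intro x hlo hhi
    have hxpos : 0 < x := lt_of_lt_of_le (by positivity) hlo
    have hx0 : x ≠ 0 := hxpos.ne'
    have hpos : 0 < |x| := abs_pos.mpr hx0
    have habs : |x| = x := abs_of_pos hxpos
    have hlog : Int.log 2 |x| = (j : ℤ) + 5 := by
      apply le_antisymm
      · have hlt : |x| < ((2 : ℕ) : ℚ) ^ ((j : ℤ) + 5 + 1) := by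
          rw [habs, Nat.cast_ofNat, zpow_add_one₀ h2, zpow_add₀ h2, zpow_natCast]; norm_num
          linarith
        have := (Int.lt_zpow_iff_log_lt (b := 2) (by norm_num) hpos).mp hlt
        omega
      · have hle : ((2 : ℕ) : ℚ) ^ ((j : ℤ) + 5) ≤ |x| := by
          rw [habs, Nat.cast_ofNat, zpow_add₀ h2, zpow_natCast]; norm_num; linarith
        exact (Int.zpow_le_iff_le_log (b := 2) (by norm_num) hpos).mp hle
    rw [ulp_of_ne_zero hx0, hlog]
    have : (j : ℤ) + 5 - ((j + 4 : ℕ) : ℤ) + 1 = 2 := by push_cast; ring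
    rw [this, max_eq_right hemin]; norm_num
  exact ⟨key _ le_rfl (by linarith), key _ (by linarith) (by linarith)⟩

/-- **THE COUNTEREXAMPLE FAMILY.**  For every precision `p ≥ 4` and every exponent floor `emin ≤ 0`:
`l = ⟨1, −(2^(p+1) − 4), −2^(p+2), 2^(p+3)⟩` is a strongly nonoverlapping (hence weakly
nonoverlapping) expansion of `p`-bit floats with `Σ l = 2^(p+1) + 5` on which `estimate` under
round-to-nearest-even returns `2^(p+1)`: the error `5` exceeds `ulp(estimate l) = 4`, exceeds
`2ε·|Σ l|` and exceeds `2ε·|estimate l|` (`ε = unitRoundoff p = 2^−p`). -/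
theorem estimate_counterexample_family {p : ℕ} (hp : 4 ≤ p) {emin : ℤ} (hemin : emin ≤ 0) :
    (∀ x ∈ [1, -((2 : ℚ) ^ (p + 1) - 4), -(2 : ℚ) ^ (p + 2), (2 : ℚ) ^ (p + 3)], IsFloat p emin x) ∧
    IsStrongExpansion [1, -((2 : ℚ) ^ (p + 1) - 4), -(2 : ℚ) ^ (p + 2), (2 : ℚ) ^ (p + 3)] ∧
    IsWeakExpansion [1, -((2 : ℚ) ^ (p + 1) - 4), -(2 : ℚ) ^ (p + 2), (2 : ℚ) ^ (p + 3)] ∧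
    ([1, -((2 : ℚ) ^ (p + 1) - 4), -(2 : ℚ) ^ (p + 2), (2 : ℚ) ^ (p + 3)] : List ℚ).sum
      = (2 : ℚ) ^ (p + 1) + 5 ∧
    estimate (roundTiesEven p emin)
      [1, -((2 : ℚ) ^ (p + 1) - 4), -(2 : ℚ) ^ (p + 2), (2 : ℚ) ^ (p + 3)] = (2 : ℚ) ^ (p + 1) ∧
    |estimate (roundTiesEven p emin)
        [1, -((2 : ℚ) ^ (p + 1) - 4), -(2 : ℚ) ^ (p + 2), (2 : ℚ) ^ (p + 3)]
      - ([1, -((2 : ℚ) ^ (p + 1) - 4), -(2 : ℚ) ^ (p + 2), (2 : ℚ) ^ (p + 3)] : List ℚ).sum| = 5 ∧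
    ulp p emin (estimate (roundTiesEven p emin)
      [1, -((2 : ℚ) ^ (p + 1) - 4), -(2 : ℚ) ^ (p + 2), (2 : ℚ) ^ (p + 3)]) = 4 ∧
    2 * unitRoundoff p *
        |([1, -((2 : ℚ) ^ (p + 1) - 4), -(2 : ℚ) ^ (p + 2), (2 : ℚ) ^ (p + 3)] : List ℚ).sum| < 5 ∧
    2 * unitRoundoff p * |estimate (roundTiesEven p emin)
        [1, -((2 : ℚ) ^ (p + 1) - 4), -(2 : ℚ) ^ (p + 2), (2 : ℚ) ^ (p + 3)]| < 5 := by
  obtain ⟨j, rfl⟩ : ∃ j, p = j + 4 := ⟨p - 4, by omega⟩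
  have ht1 : (1 : ℚ) ≤ 2 ^ j := one_le_pow₀ (by norm_num)
  have ht0 : (0 : ℚ) < 2 ^ j := by positivity
  have e1 : (2 : ℚ) ^ (j + 4 + 1) = 32 * 2 ^ j := by ring
  have e2 : (2 : ℚ) ^ (j + 4 + 2) = 64 * 2 ^ j := by ring
  have e3 : (2 : ℚ) ^ (j + 4 + 3) = 128 * 2 ^ j := by ring
  have eu : unitRoundoff (j + 4) = 1 / (16 * 2 ^ j) := by
    unfold unitRoundoff; rw [show (2 : ℚ) ^ (j + 4) = 16 * 2 ^ j by ring]
  rw [e1, e2, e3, show (-(32 * (2 : ℚ) ^ j - 4)) = 4 - 32 * 2 ^ j by ring, estimate_ce j hemin,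
    ce_sum j, eu]
  refine ⟨ce_isFloat j hemin, ce_isStrongExpansion j,
    IsStrongExpansion.isWeakExpansion (ce_isStrongExpansion j), rfl, rfl, ?_,
    (ulp_ce j (by omega)).1, ?_, ?_⟩
  · rw [show (32 * 2 ^ j - (32 * 2 ^ j + 5) : ℚ) = -5 by ring]; norm_num
  · rw [abs_of_pos (by positivity),
      show (2 : ℚ) * (1 / (16 * 2 ^ j)) * (32 * 2 ^ j + 5) = 4 + 5 / (8 * 2 ^ j) by
        field_simp; ring]
    have : (5 : ℚ) / (8 * 2 ^ j) < 1 := by rw [div_lt_one (by positivity)]; linarith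
    linarith
  · rw [abs_of_pos (by positivity),
      show (2 : ℚ) * (1 / (16 * 2 ^ j)) * (32 * 2 ^ j) = 4 by field_simp; ring]
    norm_num

/-- **THE §2.7 REMARK IS FALSE AS PRINTED** ([Shewchuk1997] p. 333: summing a nonoverlapping
expansion smallest-to-largest "errs by less than one ulp"), for every `p ≥ 4` and `emin ≤ 0` —
even restricted to STRONGLY nonoverlapping float expansions with nonzero sum, round-to-EVEN. -/
theorem approximateRemark_false {p : ℕ} (hp : 4 ≤ p) {emin : ℤ} (hemin : emin ≤ 0) :
    ¬ ∀ l : List ℚ, (∀ x ∈ l, IsFloat p emin x) → IsStrongExpansion l → l.sum ≠ 0 →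
        |estimate (roundTiesEven p emin) l - l.sum|
          < ulp p emin (estimate (roundTiesEven p emin) l) := by
  intro h
  obtain ⟨hF, hS, -, hsum, -, habs, hulp, -⟩ := estimate_counterexample_family hp hemin
  have := h _ hF hS (by rw [hsum]; positivity)
  rw [habs, hulp] at this
  norm_num at this

/-- **THE `2ε` OF P. 349 FAILS** ([Shewchuk1997] §4.3: APPROXIMATE has "relative error less than
`2ε`"), for every `p ≥ 4` and `emin ≤ 0`, on strongly nonoverlapping expansions under
round-to-even — whether the error is measured against the true sum or the computed value. -/
theorem approximateTwoEps_false {p : ℕ} (hp : 4 ≤ p) {emin : ℤ} (hemin : emin ≤ 0) :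
    (¬ ∀ l : List ℚ, (∀ x ∈ l, IsFloat p emin x) → IsStrongExpansion l →
        |estimate (roundTiesEven p emin) l - l.sum| ≤ 2 * unitRoundoff p * |l.sum|) ∧
    (¬ ∀ l : List ℚ, (∀ x ∈ l, IsFloat p emin x) → IsStrongExpansion l →
        |estimate (roundTiesEven p emin) l - l.sum|
          ≤ 2 * unitRoundoff p * |estimate (roundTiesEven p emin) l|) := by
  obtain ⟨hF, hS, -, -, -, habs, -, hlt₁, hlt₂⟩ := estimate_counterexample_family hp hemin
  exact ⟨fun h => by have := h _ hF hS; rw [habs] at this; linarith,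
    fun h => by have := h _ hF hS; rw [habs] at this; linarith⟩

/-- The smallest instance, `p = 4`: `l = ⟨1, −28, −64, 128⟩` (`1 | −11100 | −1000000 | 10000000`),
`estimate = ((1 ⊕ −28) ⊕ −64) ⊕ 128 = −96 ⊕ 128 = 32`, `Σ = 37`: error `5 > 4 = ulp(32)`. -/
theorem estimate_counterexample_four {emin : ℤ} (hemin : emin ≤ 0) :
    IsStrongExpansion [1, -28, -64, 128] ∧
    estimate (roundTiesEven 4 emin) [1, -28, -64, 128] = 32 ∧
    ([1, -28, -64, 128] : List ℚ).sum = 37 ∧ ulp 4 emin 32 = 4 := by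
  have h₁ := ce_isStrongExpansion 0
  have h₂ := estimate_ce 0 hemin
  have h₃ := (ulp_ce 0 (by omega : emin ≤ 2)).1
  norm_num at h₁ h₂ h₃
  exact ⟨h₁, h₂, by norm_num [List.sum_cons, List.sum_nil], h₃⟩

/-- binary64 (`p = 53`, `emin = −1074`): `l = ⟨1, −(2^54 − 4), −2^55, 2^56⟩` is a strongly
nonoverlapping expansion of doubles, `estimate l = 2^54 = Σ l − 5`, `5 > 2ε|Σ l|` (`2.4999…ε`). -/
theorem estimate_counterexample_binary64 :
    IsStrongExpansion [1, -((2 : ℚ) ^ 54 - 4), -(2 : ℚ) ^ 55, (2 : ℚ) ^ 56] ∧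
    (∀ x ∈ [1, -((2 : ℚ) ^ 54 - 4), -(2 : ℚ) ^ 55, (2 : ℚ) ^ 56], IsFloat 53 (-1074) x) ∧
    estimate (roundTiesEven 53 (-1074)) [1, -((2 : ℚ) ^ 54 - 4), -(2 : ℚ) ^ 55, (2 : ℚ) ^ 56]
      = (2 : ℚ) ^ 54 ∧
    ([1, -((2 : ℚ) ^ 54 - 4), -(2 : ℚ) ^ 55, (2 : ℚ) ^ 56] : List ℚ).sum = (2 : ℚ) ^ 54 + 5 ∧
    2 * unitRoundoff 53 * |(2 : ℚ) ^ 54 + 5| < 5 := by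
  obtain ⟨hF, hS, -, hsum, hest, -, -, hlt, -⟩ :=
    estimate_counterexample_family (p := 53) (by norm_num) (show (-1074 : ℤ) ≤ 0 by norm_num)
  rw [hsum] at hlt
  exact ⟨hS, hF, hest, hsum, hlt⟩

end Summit.Ventures.CertifiedArithmetic.Expansions
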